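import Summits.PneNP.PneNP.Theorems.ChebyshevTracialDesignSmallBlockVirtualPositivity
import Summits.PneNP.PneNP.Theorems.ChebyshevTracialDesignBlockStatisticPricing
import HarnessLib

/-!
# Cell pnp-psdrank, route `ChebyshevTracialDesign`: SMALL BLOCKS WITHOUT INTERNAL EDGES — THE UNTILTED MASK `ψ(|U∩H|)`
# PRICED PER MATCHING AT `q^{D+1}`, EFFECTIVELY (crux `TracialDecayExp20`, stmt-PneNP-19878)

Brick (T-K2) (engine seat g24; eng MEMO-23 §1). Brick (T-K) (`ChebyshevTracialDesignSmallBlockVirtualPositivity`) showed that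
for a block `H` with NO matching edge inside and `b` crossing edges the odd level profile of the shell law is the binomial smoothing
profile of ONE far-rooted hypergeometric kernel in the population parameter, and deduced the brick-121 criterion AT THE BASE INDEX
`j = 0`, hence `N^{odd}_D φ_M(0) ≥ 0`. The same mechanism works at EVERY level index `j`: the exact heat equation
`Δ^k_j P_φ(j) = P_{L^kφ}(j)` (`BinomialSmoothingProfile.fwdDiff_iter_binomialProfile`) holds at all `j`, and the far-roots bound
`|(L^kφ)(K₁)| ≤ 4^{−k}(b/R)^{2k}e^{3bk/R}φ(K₁)` holds on the whole window `K₁ ∈ [s₀−j, s₀+j+1]` as long as the roots stay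
`R + 3k` away. Consequently the `(D+1)`-st level differences of the shell profile of ANY bounded mask are `≤ G·q^{D+1}`
(`q = ¼(b/R)²e^{3b/R}`) at every base level `≤ T`, which is exactly the input of the exact-design remainder lemma
(Literature `IsExactDesign.abs_levelSum_add_le_of_fwdDiff_odd`, the engine of brick 117) — with NO `x`-smoothness numbers, NO
deletion families, NO [BULK] window and NO tail:

* §1 tools: `fwdDiff_iter_one_odd_profile_at` (step-1 differences of the odd subsequence of a profile at index `j`),
  `sum_shellLaw_le_one` (the shell law has total mass `≤ 1` on every set of values), `abs_fwdDiff_iter_binomialProfile_le`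
  (transfer of a pointwise relative kernel bound to the profile at a general index `j`; (L-K2) has `j = 0`).
* §2 **`smallBlock_abs_fwdDiff_iter_le`** — for `R ≥ 1`, `R + 3k + b + j ≤ s₀ + 1`, `R + 3k + b + s₀ + j ≤ N`:
  `|Δ^k_{j'}[law_{2j'+1}(y)](j)| ≤ q^k · law_{2j+1}(y)` at every `y ∈ [0,t]`, `t = 2s₀+1`;
  **`smallBlock_sum_abs_fwdDiff_iter_le`**: `Σ_{y=0}^{t} |Δ^k_{j'}[law_{2j'+1}(y)](j)| ≤ q^k`;
  **`smallBlock_abs_fwdDiff_iter_shellProfile_le`**: `|Δ^k_{(2)} φ_M(2j+1)| ≤ G·q^k` for the shell profile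
  `φ_M(c) = E_{Shell_c(M)}[ψ(|U∩H|)]` of every `|ψ| ≤ G`.
* §3 **`smallBlock_designValue_le`** (THE PRICING): for an exact design `(n,t,T,D,B_v,C,w)`, a matching `M`, a block `H` with
  `a = 0` internal and `b` crossing edges, `t = 2s₀+1`, `R ≥ 1` with `R + 3(D+1) + b + (T−1)/2 ≤ s₀+1`,
  `R + 3(D+1) + b + s₀ + (T−1)/2 ≤ N`, `(b/R)²e^{3b/R} ≤ 2`, and every `0 ≤ ψ ≤ G` on `[0,t]`:
  `|PM|·Σ_U W(U,M)·ψ(|U∩H|) ≤ B_v·C((T−1)/2, D+1)·G·q^{D+1}` (brick 117's remainder lemma fed by §2, and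
  `N^{odd}_D φ_M(0) ≥ 0` by (T-K)); **`smallBlock_designValue_le_exp`**: if moreover `((T−1)/2)·q ≤ e^{−a′}` then
  `≤ B_v·G·e^{−a′(D+1)}`.
READING (eng MEMO-23 §1): EFFECTIVE. In the crux's parameters (`T = 4⌊√n⌋+3`, `D = ⌊n^{1/4}⌋`, `B_v = 20`, balanced cut
`s₀ ≈ n/4`, `R ≈ n/4 − 2√n − 3D − b`) the bound `20·C((T−1)/2,D+1)·q^{D+1}` is `≤ e^{−(D+1)}` for every block without internal
matching edge and `b ≤ 9 / 24 / 52 / 112 / 431 / 1592 / 19799` crossing edges at `n = 2⁹ / 2¹⁰ / 2¹¹ / 2¹² / 2¹⁴ / 2¹⁶ / 2²⁰`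
(`b ≲ 0.6·n^{3/4}`): the untilted `H`-symmetric class on SMALL blocks is priced per matching from `n = 512` on.
WHAT THIS FILE DOES NOT DO: blocks with internal matching edges `a ≥ 1` (the (K0) mixture; next brick), the average over `M`
(needs `a ≥ 1`), tilted masks; anything on `TracialDecayExp20` itself, psd rank of P_PM(K_n), or P vs NP.
[cite: Rothvoss2017, §2 (PDF p. 6)] [cite: Agarwal2000DifferenceEquations, Remark 1.8.1 (1.8.8)] [cite: Feller1968, Ch. III §2]
Stature: support/instrument (kernel lane, no defs, axioms standard). Supports stmt-PneNP-19878.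
-/

set_option linter.dupNamespace false -- `Summit.PneNP.PneNP.…`: summit = sub-problem (D-0017)

noncomputable section

namespace Summit.PneNP.PneNP.Theorems.ChebyshevTracialDesignSmallBlockMaskPricing

open Finset Polynomial Literature.Barriers.PneNP Literature.Combinatorics.Optimization
open Literature.Combinatorics.Optimization.ShellStep
open Literature.Combinatorics.StablePolynomials (hyperGen coeff_hyperGen)
open Literature.Probability.Distributions.BinomialSmoothing
open Summit.PneNP.PneNP.Theorems.ChebyshevTracialDesignVirtualPositivityCriterion (shellLaw_nonneg')
open Summit.PneNP.PneNP.Theorems.ChebyshevTracialDesignSmallBlockVirtualPositivity (smallBlock_virtualValue_nonneg)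
open Summit.PneNP.PneNP.Theorems.ChebyshevTracialDesignShellOperatorForm (designValue_eq_shellAvg)
open Summit.PneNP.PneNP.Theorems.ChebyshevTracialDesignBlockStatisticPricing (fwdDiff_iter_one_odd)

variable {n : ℕ}

/-! ### §1 Tools -/

/-- Step-`1` differences of the odd-level subsequence of a profile, at a general index:
`Δ^k_{(1)}[j' ↦ P(2j'+1)(x)](j) = (Δ^k_{(2)} P)(2j+1)(x)`. [cite: Agarwal2000DifferenceEquations, Thm. 1.8.5 (1.8.6)] -/
theorem fwdDiff_iter_one_odd_profile_at (P : Profile) (k j : ℕ) (x : ℤ) :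
    (fwdDiff (1 : ℕ))^[k] (fun j' : ℕ => P (2 * j' + 1) x) j = ((fwdDiff (2 : ℕ))^[k] P) (2 * j + 1) x := by
  rw [fwdDiff_iter_eq_sum_shift, fwdDiff_iter_eq_sum_shift]
  simp only [Finset.sum_apply, Pi.smul_apply, smul_eq_mul, mul_one]
  refine sum_congr rfl fun i _ => ?_
  congr 2
  ring

/-- **The shell law has total mass at most one** on every set of values (it is a probability law for a nonempty shell and
identically `0` for an empty one). [cite: Rothvoss2017, §2 (PDF p. 6)] -/
theorem sum_shellLaw_le_one (π : Fin n → Fin n) (S H : Finset (Fin n)) (t c : ℕ) (X : Finset ℤ) :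
    ∑ x ∈ X, shellLaw π S H t c x ≤ 1 := by
  classical
  simp only [shellLaw, shellCount]
  rw [← sum_div]
  rcases Nat.eq_zero_or_pos (shellIn π S t c).card with h0 | hpos
  · rw [h0, Nat.cast_zero, div_zero]; exact zero_le_one
  rw [div_le_one (by exact_mod_cast hpos)]
  have hfw := card_eq_sum_card_fiberwise
    (s := (shellIn π S t c).filter fun U => ((U ∩ H).card : ℤ) ∈ X)
    (f := fun U => ((U ∩ H).card : ℤ)) (t := X) (fun U hU => (mem_filter.1 hU).2)
  have h1 : ∑ x ∈ X, ((((shellIn π S t c).filter fun U => ((U ∩ H).card : ℤ) = x).card : ℕ) : ℝ) =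
      ((((shellIn π S t c).filter fun U => ((U ∩ H).card : ℤ) ∈ X).card : ℕ) : ℝ) := by
    rw [hfw]; push_cast
    refine sum_congr rfl fun x hx => ?_
    congr 2
    rw [filter_filter]
    ext U
    simp only [mem_filter]
    constructor
    · rintro ⟨hU, h⟩; exact ⟨hU, by rw [h]; exact hx, h⟩
    · rintro ⟨hU, _, h⟩; exact ⟨hU, h⟩
  rw [h1]
  exact_mod_cast card_filter_le _ _

/-- **Transfer of a pointwise relative kernel bound to the profile at a general index `j`.** If on the window
`K ∈ {s₀−j, …, s₀+j+1}` the `k`-fold quarter Laplacian of the kernel satisfies `|(L^kφ)(K)| ≤ ρ·φ(K)`, then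
`|Δ^k_j P_φ(j)| ≤ ρ·P_φ(j)` (the exact heat equation `Δ^k_j P_φ(j) = P_{L^kφ}(j)` and the triangle inequality).
[cite: Feller1968, Ch. III §2 (the symmetric random walk)] -/
theorem abs_fwdDiff_iter_binomialProfile_le (φ : ℤ → ℝ) (s₀ : ℤ) (k j : ℕ) {ρ : ℝ}
    (hbd : ∀ w ∈ range (2 * j + 2),
      |((fun ψ : ℤ → ℝ => fun K : ℤ => (ψ (K - 1) - 2 * ψ K + ψ (K + 1)) / 4)^[k] φ) (s₀ - j + w)| ≤
        ρ * φ (s₀ - j + w)) :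
    |(fwdDiff (1 : ℕ))^[k] (fun j : ℕ => ∑ w ∈ range (2 * j + 2), ((2 * j + 1).choose w : ℝ) / 2 ^ (2 * j + 1) *
        φ (s₀ - j + w)) j| ≤
      ρ * ∑ w ∈ range (2 * j + 2), ((2 * j + 1).choose w : ℝ) / 2 ^ (2 * j + 1) * φ (s₀ - j + w) := by
  rw [fwdDiff_iter_binomialProfile k φ s₀ j, mul_sum]
  refine (abs_sum_le_sum_abs _ _).trans (sum_le_sum fun w hw => ?_)
  have hc : (0 : ℝ) ≤ ((2 * j + 1).choose w : ℝ) / 2 ^ (2 * j + 1) := by positivity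
  rw [abs_mul, abs_of_nonneg hc]
  calc ((2 * j + 1).choose w : ℝ) / 2 ^ (2 * j + 1) *
        |((fun ψ : ℤ → ℝ => fun K : ℤ => (ψ (K - 1) - 2 * ψ K + ψ (K + 1)) / 4)^[k] φ) (s₀ - j + w)|
      ≤ ((2 * j + 1).choose w : ℝ) / 2 ^ (2 * j + 1) * (ρ * φ (s₀ - j + w)) :=
        mul_le_mul_of_nonneg_left (hbd w hw) hc
    _ = ρ * (((2 * j + 1).choose w : ℝ) / 2 ^ (2 * j + 1) * φ (s₀ - j + w)) := by ring

/-! ### §2 Level differences of a small block's shell law at every level index -/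

section Main

variable {π : Fin n → Fin n} (hπ : ∀ v, π (π v) = v) (hπ' : ∀ v, π v ≠ v)
include hπ hπ'

/-- **THE `k`-FOLD LEVEL DIFFERENCE OF A SMALL BLOCK'S SHELL LAW AT EVERY LEVEL INDEX.** Let `π` be a perfect matching of the
`2N` vertices, `H` a block with no matching edge inside (`a = 0`) and `b` crossing edges, `t = 2s₀+1` the cut, `k` an order,
`j` a level index, and `R ≥ 1` an integer with `R + 3k + b + j ≤ s₀ + 1` and `R + 3k + b + s₀ + j ≤ N`. Then for every
`y ∈ [0,t]`: `|Δ^k_{j'}[law_{2j'+1}(y)](j)| ≤ (¼(b/R)²e^{3b/R})^k · law_{2j+1}(y)` (`law_c(y) = shellLaw π univ H t c y`).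
(Population mixture at index `j`: the profile is the `Bin(2j+1,½)`-average of the kernel `K ↦ C(b,y)(−1)^{b−y}/(N)_b·Π_{i<b}(K − r_i)`
over `K ∈ [s₀−j, s₀+j+1]`; exact heat equation; far-roots smoothness at every point of that window; transfer §1.)
[cite: Rothvoss2017, §2 (PDF p. 6)] [cite: ChattamvelliShanmugam2020, §7.4 Table 7.1] [cite: Feller1968, Ch. III §2] -/
theorem smallBlock_abs_fwdDiff_iter_le {N : ℕ} (hn : (univ : Finset (Fin n)).card = 2 * N) (H : Finset (Fin n))
    (h0 : (reps π (vAA π univ H)).card = 0) {b : ℕ} (hb : (reps π (vBH π univ H ∪ vBN π univ H)).card = b)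
    {s₀ k j R : ℕ} (hR : 1 ≤ R) (hR1 : R + 3 * k + b + j ≤ s₀ + 1) (hR2 : R + 3 * k + b + s₀ + j ≤ N) :
    ∀ y ∈ Icc (0 : ℤ) ((2 * s₀ + 1 : ℕ) : ℤ),
      |(fwdDiff (1 : ℕ))^[k] (fun j' => shellLaw π univ H (2 * s₀ + 1) (2 * j' + 1) y) j| ≤
        ((1 / 4 : ℝ) * ((b : ℝ) / R) ^ 2 * Real.exp (3 * b / R)) ^ k *
          shellLaw π univ H (2 * s₀ + 1) (2 * j + 1) y := by
  classical
  intro y hy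
  obtain ⟨m, rfl⟩ : ∃ m : ℕ, y = (m : ℤ) := Int.eq_ofNat_of_zero_le (mem_Icc.1 hy).1
  have hS : ∀ v ∈ (univ : Finset (Fin n)), π v ∈ univ := fun v _ => mem_univ _
  have hA := noHH_of_card_reps_vAA_eq_zero hπ hπ' hS H h0
  -- the type: `a = 0`, `b` mixed, `d = N − b`
  have hd : (reps π (vDD π univ H)).card = N - b := by
    have h2 := two_mul_typeReps_eq_card hπ hπ' hS H
    rw [h0, hb, hn] at h2
    omega
  have hbN : b ≤ N := by omega
  have hRpos : (0 : ℝ) < R := by exact_mod_cast hR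
  /- ───── the kernel `ψ(K) = c·Π_{i<b}(K − r_i)` ───── -/
  obtain ⟨root, hroot⟩ : ∃ f : ℕ → ℝ, f = fun i => if i < m then (i : ℝ) else (N : ℝ) - ((i - m : ℕ) : ℝ) := ⟨_, rfl⟩
  obtain ⟨c, hc⟩ : ∃ e : ℝ, e = ((b.choose m : ℕ) : ℝ) * (-1) ^ (b - m) / N.descFactorial b := ⟨_, rfl⟩
  obtain ⟨ψ, hψ⟩ : ∃ g : ℤ → ℝ, g = fun K : ℤ => c * ∏ i ∈ range b, (((K : ℤ) : ℝ) - root i) := ⟨_, rfl⟩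
  -- (S1) the level-`0` laws on the window `[s₀ − j − k, s₀ + j + k + 1]` are the kernel
  have hker : ∀ K : ℤ, (s₀ : ℤ) - j - k ≤ K → K ≤ (s₀ : ℤ) + j + k + 1 →
      shellLaw π univ H (2 * K.toNat) 0 (m : ℤ) = ψ K := by
    intro K hK1 hK2
    have hK0 : 0 ≤ K := by
      have : (j : ℤ) + k ≤ s₀ := by exact_mod_cast (show j + k ≤ s₀ by omega)
      linarith
    obtain ⟨Kn, rfl⟩ : ∃ Kn : ℕ, K = (Kn : ℤ) := Int.eq_ofNat_of_zero_le hK0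
    rw [Int.toNat_natCast]
    have hKn1 : b ≤ Kn := by
      have h' : (s₀ : ℤ) ≤ Kn + j + k := by linarith
      have h'' : s₀ ≤ Kn + j + k := by exact_mod_cast h'
      omega
    have hKn2 : Kn + b ≤ N := by
      have h' : (Kn : ℤ) ≤ s₀ + j + k + 1 := hK2
      have h'' : Kn ≤ s₀ + j + k + 1 := by exact_mod_cast h'
      omega
    rw [shellLaw_zero_eq hπ hπ' hS hn H h0 Kn m, hb, hd, coeff_hyperGen, hψ, hc, hroot]
    by_cases hm : m ≤ b
    · rw [if_pos (by omega : m ≤ Kn)]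
      have hk := hypergeomPopulationKernel_eq_prod (N := N) hm hKn1 hKn2
      push_cast at hk ⊢
      rw [hk]
    · have hz : b.choose m = 0 := Nat.choose_eq_zero_of_lt (by omega)
      simp [hz]
  -- (S2) the odd-level laws are the binomial smoothing profile of `ψ`, at every index `i ≤ j + k`
  have hprof : ∀ i : ℕ, i ≤ j + k →
      shellLaw π univ H (2 * s₀ + 1) (2 * i + 1) (m : ℤ) =
        ∑ w ∈ range (2 * i + 2), ((2 * i + 1).choose w : ℝ) / 2 ^ (2 * i + 1) * ψ ((s₀ : ℤ) - i + w) := by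
    intro i hi
    rw [shellLaw_odd_eq_binomialProfile hπ hπ' hS hn hA (by omega : i ≤ s₀) (by omega : s₀ + i + 1 ≤ N) (m : ℤ)]
    refine sum_congr rfl fun w hw => ?_
    have hw' : w ≤ 2 * i + 1 := Nat.lt_succ_iff.1 (mem_range.1 hw)
    simp only
    have hi' : (i : ℤ) ≤ j + k := by exact_mod_cast hi
    have hwz : (w : ℤ) ≤ 2 * i + 1 := by exact_mod_cast hw'
    rw [hker ((s₀ : ℤ) - i + w) (by linarith [Int.natCast_nonneg w]) (by linarith)]
  -- (S3) hence the same forward differences at `j` (locality: only `j ≤ i ≤ j + k` is sampled)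
  have hΔ : (fwdDiff (1 : ℕ))^[k] (fun j' => shellLaw π univ H (2 * s₀ + 1) (2 * j' + 1) (m : ℤ)) j =
        (fwdDiff (1 : ℕ))^[k] (fun j' : ℕ => ∑ w ∈ range (2 * j' + 2),
          ((2 * j' + 1).choose w : ℝ) / 2 ^ (2 * j' + 1) * ψ ((s₀ : ℤ) - j' + w)) j := by
    rw [fwdDiff_iter_eq_sum_shift, fwdDiff_iter_eq_sum_shift]
    refine sum_congr rfl fun i hi => ?_
    have hi' : i ≤ k := Nat.lt_succ_iff.1 (mem_range.1 hi)
    congr 1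
    simp only [smul_eq_mul, mul_one]
    exact hprof (j + i) (by omega)
  -- (S4) far-roots smoothness of the kernel on the window `K₁ ∈ [s₀ − j, s₀ + j + 1]`
  have hψpoly : ∀ K : ℤ, ψ K = c * (∏ i ∈ range b, (Polynomial.X - Polynomial.C (root i))).eval (K : ℝ) := by
    intro K; rw [hψ, Polynomial.eval_prod]; simp
  have hψnn : ∀ w ∈ range (2 * j + 2), 0 ≤ ψ ((s₀ : ℤ) - j + w) := by
    intro w hw
    have hw' : w ≤ 2 * j + 1 := Nat.lt_succ_iff.1 (mem_range.1 hw)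
    have hwz : (w : ℤ) ≤ 2 * j + 1 := by exact_mod_cast hw'
    rw [← hker ((s₀ : ℤ) - j + w) (by linarith [Int.natCast_nonneg w, Int.natCast_nonneg k])
      (by linarith [Int.natCast_nonneg k])]
    exact shellLaw_nonneg' _ _ _ _ _
  have hfar : ∀ w ∈ range (2 * j + 2), ∀ i, i < b →
      (R : ℝ) + 3 * k ≤ |((((s₀ : ℤ) - j + w : ℤ)) : ℝ) - root i| := by
    intro w hw i hi
    have hw' : w ≤ 2 * j + 1 := Nat.lt_succ_iff.1 (mem_range.1 hw)
    have hK₁lo : (s₀ : ℝ) - j ≤ ((((s₀ : ℤ) - j + w : ℤ)) : ℝ) ∧ ((((s₀ : ℤ) - j + w : ℤ)) : ℝ) ≤ s₀ + j + 1 := by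
      have hwr : (w : ℝ) ≤ 2 * j + 1 := by exact_mod_cast hw'
      push_cast
      constructor <;> linarith [(Nat.cast_nonneg w : (0 : ℝ) ≤ w)]
    have hR1' : (R : ℝ) + 3 * k + b + j ≤ s₀ + 1 := by exact_mod_cast hR1
    have hR2' : (R : ℝ) + 3 * k + b + s₀ + j ≤ N := by exact_mod_cast hR2
    have hib : (i : ℝ) + 1 ≤ b := by exact_mod_cast hi
    rw [hroot]
    simp only
    split_ifs with him
    · -- root `i ≤ b − 1` below the window
      rw [abs_of_nonneg (by linarith [hK₁lo.1])]
      linarith [hK₁lo.1]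
    · -- root `N − (i − m) ≥ N − b + 1` above the window
      have him' : ((i - m : ℕ) : ℝ) ≤ i := by
        have : i - m ≤ i := Nat.sub_le _ _
        exact_mod_cast this
      rw [abs_of_nonpos (by linarith [hK₁lo.2])]
      linarith [hK₁lo.2]
  have hbd : ∀ w ∈ range (2 * j + 2),
      |((fun φ : ℤ → ℝ => fun K : ℤ => (φ (K - 1) - 2 * φ K + φ (K + 1)) / 4)^[k] ψ) ((s₀ : ℤ) - j + w)| ≤
        ((1 / 4 : ℝ) ^ k * (((b : ℝ) / R) ^ (2 * k) * Real.exp (b * (2 * k : ℕ) / R)) * Real.exp (b * k / R)) *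
          ψ ((s₀ : ℤ) - j + w) := by
    intro w hw
    have h := abs_laplaceQuarter_iter_prodKernel_le root b k c hRpos ψ hψpoly ((s₀ : ℤ) - j + w) (hfar w hw)
    rwa [abs_of_nonneg (hψnn w hw)] at h
  -- (S5) transfer to the profile at index `j`
  have hT := abs_fwdDiff_iter_binomialProfile_le ψ (s₀ : ℤ) k j hbd
  -- (S6) the smoothness constant is `q^k`
  have hρ : (1 / 4 : ℝ) ^ k * (((b : ℝ) / R) ^ (2 * k) * Real.exp (b * (2 * k : ℕ) / R)) *
      Real.exp (b * k / R) = ((1 / 4 : ℝ) * ((b : ℝ) / R) ^ 2 * Real.exp (3 * b / R)) ^ k := by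
    have e1 : ((b : ℝ) / R) ^ (2 * k) = (((b : ℝ) / R) ^ 2) ^ k := pow_mul _ 2 k
    have e2 : Real.exp (b * ((2 * k : ℕ) : ℝ) / R) * Real.exp (b * k / R) = Real.exp (3 * b / R) ^ k := by
      rw [← Real.exp_add, ← Real.exp_nat_mul]
      congr 1
      push_cast
      ring
    rw [mul_pow, mul_pow, e1, mul_assoc, mul_assoc, e2]
    ring
  rw [hΔ]
  exact hT.trans (le_of_eq (by rw [hρ, ← hprof j (Nat.le_add_right j k)]))

/-- **The `ℓ¹` form**: under the hypotheses of `smallBlock_abs_fwdDiff_iter_le`,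
`Σ_{y=0}^{t} |Δ^k_{j'}[law_{2j'+1}(y)](j)| ≤ (¼(b/R)²e^{3b/R})^k` (the law at level `2j+1` has mass `≤ 1`).
[cite: Rothvoss2017, §2 (PDF p. 6)] [cite: Feller1968, Ch. III §2] -/
theorem smallBlock_sum_abs_fwdDiff_iter_le {N : ℕ} (hn : (univ : Finset (Fin n)).card = 2 * N) (H : Finset (Fin n))
    (h0 : (reps π (vAA π univ H)).card = 0) {b : ℕ} (hb : (reps π (vBH π univ H ∪ vBN π univ H)).card = b)
    {s₀ k j R : ℕ} (hR : 1 ≤ R) (hR1 : R + 3 * k + b + j ≤ s₀ + 1) (hR2 : R + 3 * k + b + s₀ + j ≤ N) :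
    ∑ y ∈ Icc (0 : ℤ) ((2 * s₀ + 1 : ℕ) : ℤ),
        |(fwdDiff (1 : ℕ))^[k] (fun j' => shellLaw π univ H (2 * s₀ + 1) (2 * j' + 1) y) j| ≤
      ((1 / 4 : ℝ) * ((b : ℝ) / R) ^ 2 * Real.exp (3 * b / R)) ^ k := by
  have hq0 : (0 : ℝ) ≤ ((1 / 4 : ℝ) * ((b : ℝ) / R) ^ 2 * Real.exp (3 * b / R)) ^ k := by positivity
  calc ∑ y ∈ Icc (0 : ℤ) ((2 * s₀ + 1 : ℕ) : ℤ),
          |(fwdDiff (1 : ℕ))^[k] (fun j' => shellLaw π univ H (2 * s₀ + 1) (2 * j' + 1) y) j|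
      ≤ ∑ y ∈ Icc (0 : ℤ) ((2 * s₀ + 1 : ℕ) : ℤ),
          ((1 / 4 : ℝ) * ((b : ℝ) / R) ^ 2 * Real.exp (3 * b / R)) ^ k *
            shellLaw π univ H (2 * s₀ + 1) (2 * j + 1) y :=
        sum_le_sum (smallBlock_abs_fwdDiff_iter_le hπ hπ' hn H h0 hb hR hR1 hR2)
    _ = ((1 / 4 : ℝ) * ((b : ℝ) / R) ^ 2 * Real.exp (3 * b / R)) ^ k *
          ∑ y ∈ Icc (0 : ℤ) ((2 * s₀ + 1 : ℕ) : ℤ), shellLaw π univ H (2 * s₀ + 1) (2 * j + 1) y := by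
        rw [mul_sum]
    _ ≤ ((1 / 4 : ℝ) * ((b : ℝ) / R) ^ 2 * Real.exp (3 * b / R)) ^ k * 1 :=
        mul_le_mul_of_nonneg_left (sum_shellLaw_le_one π univ H _ _ _) hq0
    _ = _ := mul_one _

end Main

/-- **Level differences of the shell profile of a bounded mask on a small block.** For a perfect matching `M` of `[n]`
(`n = 2N`), a block `H` with no `M`-edge inside and `b` crossing edges, `t = 2s₀+1`, `|ψ| ≤ G` on `[0,t]`, and
`R ≥ 1`, `R + 3k + b + j ≤ s₀+1`, `R + 3k + b + s₀ + j ≤ N`: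
`|Δ^k_{(1)}[j' ↦ E_{Shell_{2j'+1}(M)}[ψ(|U∩H|)]](j)| ≤ G·(¼(b/R)²e^{3b/R})^k`.
[cite: Rothvoss2017, §2 (PDF p. 6)] [cite: RollinRoss2010, §3 (Lemma 3.1)] -/
theorem smallBlock_abs_fwdDiff_iter_shellProfile_le (M : PMatch n) {N : ℕ} (hn : (univ : Finset (Fin n)).card = 2 * N)
    (H : Finset (Fin n)) (h0 : (reps M.2.partner (vAA M.2.partner univ H)).card = 0) {b : ℕ}
    (hb : (reps M.2.partner (vBH M.2.partner univ H ∪ vBN M.2.partner univ H)).card = b)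
    {s₀ k j R : ℕ} (hR : 1 ≤ R) (hR1 : R + 3 * k + b + j ≤ s₀ + 1) (hR2 : R + 3 * k + b + s₀ + j ≤ N)
    (ψ : ℤ → ℝ) {G : ℝ} (hG : ∀ x ∈ Icc (0 : ℤ) ((2 * s₀ + 1 : ℕ) : ℤ), |ψ x| ≤ G) :
    |((fwdDiff (1 : ℕ))^[k] (fun j' => (∑ U ∈ shell M.2.partner (2 * s₀ + 1) (2 * j' + 1), ψ ((U ∩ H).card : ℤ)) /
        ((shell M.2.partner (2 * s₀ + 1) (2 * j' + 1)).card : ℝ))) j| ≤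
      G * ((1 / 4 : ℝ) * ((b : ℝ) / R) ^ 2 * Real.exp (3 * b / R)) ^ k := by
  have hπ : ∀ v, M.2.partner (M.2.partner v) = v := partner_partner M
  have hπ' : ∀ v, M.2.partner v ≠ v := partner_ne M
  have hG0 : 0 ≤ G := (abs_nonneg _).trans (hG 0 (mem_Icc.2 ⟨le_rfl, by positivity⟩))
  set φ : ℕ → ℝ := fun c => (∑ U ∈ shell M.2.partner (2 * s₀ + 1) c, ψ ((U ∩ H).card : ℤ)) /
    ((shell M.2.partner (2 * s₀ + 1) c).card : ℝ) with hφ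
  have e : (fun j' : ℕ => (∑ U ∈ shell M.2.partner (2 * s₀ + 1) (2 * j' + 1), ψ ((U ∩ H).card : ℤ)) /
      ((shell M.2.partner (2 * s₀ + 1) (2 * j' + 1)).card : ℝ)) = fun j' => φ (2 * j' + 1) := rfl
  rw [e, fwdDiff_iter_one_odd, hφ]
  refine (abs_fwdDiff_iter_shellAvg_le H (2 * s₀ + 1) k (2 * j + 1) ψ hG).trans
    (mul_le_mul_of_nonneg_left ?_ hG0)
  calc ∑ x ∈ Icc (0 : ℤ) ((2 * s₀ + 1 : ℕ) : ℤ),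
          |(fwdDiff 2)^[k] (fun c' x => shellLaw M.2.partner univ H (2 * s₀ + 1) c' x : Profile) (2 * j + 1) x|
      = ∑ x ∈ Icc (0 : ℤ) ((2 * s₀ + 1 : ℕ) : ℤ),
          |(fwdDiff (1 : ℕ))^[k] (fun j' => shellLaw M.2.partner univ H (2 * s₀ + 1) (2 * j' + 1) x) j| := by
        refine sum_congr rfl fun x _ => ?_
        rw [fwdDiff_iter_one_odd_profile_at]
    _ ≤ _ := smallBlock_sum_abs_fwdDiff_iter_le hπ hπ' hn H h0 hb hR hR1 hR2

/-! ### §3 The pricing theorem -/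

/-- **SMALL BLOCKS WITHOUT INTERNAL EDGES: THE UNTILTED MASK PRICED PER MATCHING (brick T-K2).** For an exact design
`(n,t,T,D,B_v,C,w)`, a perfect matching `M` of `[n]` (`n = 2N`), a block `H` with NO `M`-edge inside and `b` crossing edges, the cut
`t = 2s₀+1`, an integer `R ≥ 1` with `R + 3(D+1) + b + (T−1)/2 ≤ s₀ + 1`, `R + 3(D+1) + b + s₀ + (T−1)/2 ≤ N` and
`(b/R)²·e^{3b/R} ≤ 2`, and every mask `0 ≤ ψ ≤ G` on `[0,t]`:
`|PM|·Σ_U W(U,M)·ψ(|U∩H|) ≤ B_v·C((T−1)/2, D+1)·G·(¼(b/R)²e^{3b/R})^{D+1}`.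
Proof: `Σ_U W ψ = |PM|⁻¹Σ_c w_c φ_M(c)` (`designValue_eq_shellAvg`); the exact-design remainder
`|Σ_c w_c φ_M(c) + N^{odd}_D φ_M(0)| ≤ B_v·C((T−1)/2,D+1)·max_j |Δ^{D+1}φ_M|` fed by §2; `N^{odd}_D φ_M(0) ≥ 0` by (T-K).
[cite: Rothvoss2017, §2 (PDF p. 6)] [cite: Agarwal2000DifferenceEquations, Remark 1.8.1 (1.8.8)] [cite: GriblingDelaatLaurent2019, §5] -/
theorem smallBlock_designValue_le {t T D : ℕ} {Bv : ℝ} {C : Finset ℕ} {w : ℕ → ℝ}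
    (hdes : IsExactDesign n t T D Bv C w) (M : PMatch n) {N : ℕ} (hn : (univ : Finset (Fin n)).card = 2 * N)
    (H : Finset (Fin n)) (h0 : (reps M.2.partner (vAA M.2.partner univ H)).card = 0) {b : ℕ}
    (hb : (reps M.2.partner (vBH M.2.partner univ H ∪ vBN M.2.partner univ H)).card = b)
    {s₀ R : ℕ} (ht : t = 2 * s₀ + 1) (hR : 1 ≤ R) (hR1 : R + 3 * (D + 1) + b + (T - 1) / 2 ≤ s₀ + 1)
    (hR2 : R + 3 * (D + 1) + b + s₀ + (T - 1) / 2 ≤ N) (hq : ((b : ℝ) / R) ^ 2 * Real.exp (3 * b / R) ≤ 2)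
    (ψ : ℤ → ℝ) {G : ℝ} (hG : ∀ x ∈ Icc (0 : ℤ) (t : ℤ), |ψ x| ≤ G) (hψ0 : ∀ x ∈ Icc (0 : ℤ) (t : ℤ), 0 ≤ ψ x) :
    (Fintype.card (PMatch n) : ℝ) * ∑ U : OddSet n, levelWeight n t C w U M * ψ ((U.1 ∩ H).card : ℤ) ≤
      Bv * ((((T - 1) / 2).choose (D + 1) : ℕ) : ℝ) *
        (G * ((1 / 4 : ℝ) * ((b : ℝ) / R) ^ 2 * Real.exp (3 * b / R)) ^ (D + 1)) := by
  subst ht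
  have hπ : ∀ v, M.2.partner (M.2.partner v) = v := partner_partner M
  have hπ' : ∀ v, M.2.partner v ≠ v := partner_ne M
  have hG0 : 0 ≤ G := (abs_nonneg _).trans (hG 0 (mem_Icc.2 ⟨le_rfl, by positivity⟩))
  set φ : ℕ → ℝ := fun c => (∑ U ∈ shell M.2.partner (2 * s₀ + 1) c, ψ ((U ∩ H).card : ℤ)) /
    ((shell M.2.partner (2 * s₀ + 1) c).card : ℝ) with hφ
  set q : ℝ := (1 / 4 : ℝ) * ((b : ℝ) / R) ^ 2 * Real.exp (3 * b / R) with hqdef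
  have hq0 : 0 ≤ q := by rw [hqdef]; positivity
  -- the `(D+1)`-st level differences of the profile at every base level `≤ T`
  have hK : ∀ j : ℕ, 2 * (j + D + 1) + 1 ≤ T →
      |((fwdDiff (1 : ℕ))^[D + 1] (fun j => φ (2 * j + 1))) j| ≤ G * q ^ (D + 1) := by
    intro j hj
    have hjT : j ≤ (T - 1) / 2 := by omega
    exact smallBlock_abs_fwdDiff_iter_shellProfile_le M hn H h0 hb hR (by omega) (by omega) ψ hG
  have hrem := hdes.abs_levelSum_add_le_of_fwdDiff_odd φ (by positivity) hK
  -- the virtual value is nonnegative, by (T-K)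
  have hvirt : 0 ≤ (DesignRemainder.newtonPolyOdd D φ).eval 0 :=
    smallBlock_virtualValue_nonneg hπ hπ' hn H h0 hb hR (by omega) (by omega) hq ψ hψ0
      (fun x hx => (le_abs_self _).trans (hG x hx))
  -- `|PM|·Σ_U W ψ = Σ_c w_c φ(c)`
  have hPM : (Fintype.card (PMatch n) : ℝ) ≠ 0 := by
    have : 0 < Fintype.card (PMatch n) := Fintype.card_pos_iff.2 ⟨M⟩
    positivity
  rw [designValue_eq_shellAvg (2 * s₀ + 1) hdes.1 C w M (fun U => ψ ((U ∩ H).card : ℤ)), ← mul_assoc,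
    mul_inv_cancel₀ hPM, one_mul]
  have h2 := (abs_le.1 hrem).2
  linarith

/-- **Exponential form.** Under the hypotheses of `smallBlock_designValue_le`, if moreover `((T−1)/2)·q ≤ e^{−a′}` with
`q = ¼(b/R)²e^{3b/R}` and `B_v ≥ 0`, then `|PM|·Σ_U W(U,M)·ψ(|U∩H|) ≤ B_v·G·e^{−a′(D+1)}` (`C(m,k)·q^k ≤ (mq)^k`).
[cite: Rothvoss2017, §2 (PDF p. 6)] [cite: Agarwal2000DifferenceEquations, Remark 1.8.1 (1.8.8)] -/
theorem smallBlock_designValue_le_exp {t T D : ℕ} {Bv : ℝ} {C : Finset ℕ} {w : ℕ → ℝ}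
    (hdes : IsExactDesign n t T D Bv C w) (hBv : 0 ≤ Bv) (M : PMatch n) {N : ℕ}
    (hn : (univ : Finset (Fin n)).card = 2 * N)
    (H : Finset (Fin n)) (h0 : (reps M.2.partner (vAA M.2.partner univ H)).card = 0) {b : ℕ}
    (hb : (reps M.2.partner (vBH M.2.partner univ H ∪ vBN M.2.partner univ H)).card = b)
    {s₀ R : ℕ} (ht : t = 2 * s₀ + 1) (hR : 1 ≤ R) (hR1 : R + 3 * (D + 1) + b + (T - 1) / 2 ≤ s₀ + 1)
    (hR2 : R + 3 * (D + 1) + b + s₀ + (T - 1) / 2 ≤ N) (hq : ((b : ℝ) / R) ^ 2 * Real.exp (3 * b / R) ≤ 2)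
    {a' : ℝ} (hqa : (((T - 1) / 2 : ℕ) : ℝ) * ((1 / 4 : ℝ) * ((b : ℝ) / R) ^ 2 * Real.exp (3 * b / R)) ≤ Real.exp (-a'))
    (ψ : ℤ → ℝ) {G : ℝ} (hG : ∀ x ∈ Icc (0 : ℤ) (t : ℤ), |ψ x| ≤ G) (hψ0 : ∀ x ∈ Icc (0 : ℤ) (t : ℤ), 0 ≤ ψ x) :
    (Fintype.card (PMatch n) : ℝ) * ∑ U : OddSet n, levelWeight n t C w U M * ψ ((U.1 ∩ H).card : ℤ) ≤
      Bv * G * Real.exp (-(a' * (D + 1))) := by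
  have hG0 : 0 ≤ G := (abs_nonneg _).trans (hG 0 (mem_Icc.2 ⟨le_rfl, by positivity⟩))
  set q : ℝ := (1 / 4 : ℝ) * ((b : ℝ) / R) ^ 2 * Real.exp (3 * b / R) with hqdef
  have hq0 : 0 ≤ q := by rw [hqdef]; positivity
  refine (smallBlock_designValue_le hdes M hn H h0 hb ht hR hR1 hR2 hq ψ hG hψ0).trans ?_
  rw [← hqdef]
  -- `C(m,k) q^k ≤ (m q)^k ≤ e^{−a′ k}`
  have hchoose : ((((T - 1) / 2).choose (D + 1) : ℕ) : ℝ) ≤ ((((T - 1) / 2 : ℕ) : ℝ)) ^ (D + 1) := by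
    exact_mod_cast Nat.choose_le_pow ((T - 1) / 2) (D + 1)
  have hmq : ((((T - 1) / 2 : ℕ) : ℝ)) ^ (D + 1) * q ^ (D + 1) ≤ Real.exp (-(a' * (D + 1))) := by
    rw [← mul_pow, show -(a' * (D + 1)) = ((D + 1 : ℕ) : ℝ) * (-a') by push_cast; ring, Real.exp_nat_mul]
    exact pow_le_pow_left₀ (by positivity) hqa _
  calc Bv * ((((T - 1) / 2).choose (D + 1) : ℕ) : ℝ) * (G * q ^ (D + 1))
      = Bv * G * (((((T - 1) / 2).choose (D + 1) : ℕ) : ℝ) * q ^ (D + 1)) := by ring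
    _ ≤ Bv * G * (((((T - 1) / 2 : ℕ) : ℝ)) ^ (D + 1) * q ^ (D + 1)) := by
        gcongr
    _ ≤ Bv * G * Real.exp (-(a' * (D + 1))) :=
        mul_le_mul_of_nonneg_left hmq (mul_nonneg hBv hG0)

end Summit.PneNP.PneNP.Theorems.ChebyshevTracialDesignSmallBlockMaskPricing

end
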